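import Summits.QuantumAdvantage.QuantumAdvantage.Theorems.CharDialRankRateA

/-! # CharDialRankRate — part 2/2 (mechanical split for landing of `CharDialRankRate`; content verbatim; scopes re-opened with their variables) -/

noncomputable section
open Finset
open Summit.QuantumAdvantage.AdviceFreeQNC0 Summit.QuantumAdvantage.AdviceFreeQNC0.JLinPeel

namespace Summit.QuantumAdvantage.AdviceFreeQNC0.JLinPeel
open AffBells22 AffBells23 Subcube

section SubRankD
variable (p : ℕ) [Fact p.Prime] {n : ℕ}

/-- **the dense case, density `1/λ`, half-size subcubes**: all nonzero combinations have `≥ (n−|W|)/λ` nonzero coefficients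
off `W`, `2|W| ≤ n`, `E·(r+1)·λ²·(log₂ n)⁴ ≤ n` ⟹ transport (§22) + `form_reductionRGD`. -/
theorem subRank_denseD (hp : 5 ≤ p) : ∃ θ : ℝ, θ < 1 ∧ ∃ E n₀ : ℕ, ∀ n ≥ n₀, ∀ (r lam : ℕ),
    E * (r + 1) * lam ^ 2 * (Nat.log 2 n) ^ 4 ≤ n →
    ∀ (W : Finset (Fin n)) (β : Fin n → Bool) (c : ℕ) (A : Fin r → Fin n → ZMod p)
      (Y : (Fin r → ZMod p) → Fin (n + 1) → (Fin n → Bool) → Bool),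
      2 * W.card ≤ n →
      (∀ s g, ∃ J : Finset (Fin n), J.card ≤ Nat.log 2 n ∧ ∀ u v : Fin n → Bool, (∀ i ∈ J, u i = v i) →
        Y s g u = Y s g v) →
      (∀ t : Fin r → ZMod p, t ≠ 0 →
        n - W.card ≤ lam * (univ.filter fun i : Fin n => i ∉ W ∧ WindowCounter.comb p t A i ≠ 0).card) →
      ((univ.filter fun u : Fin n → Bool =>
          ringWinU c (WindowCounter.formStratR p A Y) (subcubeMerge W β u) = true).card : ℝ) ≤ θ * 2 ^ n := by
  obtain ⟨θ₁, hθ₁, hred⟩ := WindowCounter.form_reductionRGD p hp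
  obtain ⟨E, N₀, hN₀⟩ := hred 3
  obtain ⟨N₁, hN₁⟩ := WindowCounter.log_le_sq_log 2
  set M := max (max N₀ N₁) 1 with hMdef
  refine ⟨θ₁, hθ₁, 2 * E, 2 * M, fun n hn r lam hE W β c A Y hW hY hdense => ?_⟩
  set N := n - W.card with hNdef
  have hWn : W.card + N = n := card_add_sub W
  have hnN : n ≤ 2 * N := by omega
  have hMN : M ≤ N := by omega
  have hNN₀ : N₀ ≤ N := le_trans (le_trans (le_max_left _ _) (le_max_left _ _)) hMN
  have hNN₁ : N₁ ≤ N := le_trans (le_trans (le_max_right _ _) (le_max_left _ _)) hMN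
  have hN1 : 1 ≤ N := le_trans (le_max_right _ _) hMN
  have hNn : N ≤ n := Nat.sub_le _ _
  have hE' : E * (r + 1) * lam ^ 2 * (Nat.log 2 N) ^ 4 ≤ N := by
    have h1 : E * (r + 1) * lam ^ 2 * (Nat.log 2 N) ^ 4 ≤ E * (r + 1) * lam ^ 2 * (Nat.log 2 n) ^ 4 :=
      Nat.mul_le_mul_left _ (Nat.pow_le_pow_left (Nat.log_mono_right hNn) 4)
    have h2 : 2 * (E * (r + 1) * lam ^ 2 * (Nat.log 2 n) ^ 4) ≤ n :=
      calc 2 * (E * (r + 1) * lam ^ 2 * (Nat.log 2 n) ^ 4) = 2 * E * (r + 1) * lam ^ 2 * (Nat.log 2 n) ^ 4 := by ring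
        _ ≤ n := hE
    omega
  -- counting on the subcube ≤ 2^{|W|} · counting on the free cube
  have h1 := card_filter_merge_le W β (fun u : Fin n → Bool => ringWinU c (WindowCounter.formStratR p A Y) u = true)
  -- the free game is the generalised `r`-form dial of the restricted directions
  set σ : Fin r → ZMod p := fun j => ∑ i ∈ W, if β i = true then A j i else 0 with hσ
  set A' : Fin r → Fin N → ZMod p := fun j => res W (A j) with hA'
  set Y' : (Fin r → ZMod p) → Fin (n + 1) → (Fin N → Bool) → Bool := fun s g v => Y (σ + s) g (ext W β v) with hY'
  have hstr : (fun g (v : Fin N → Bool) => WindowCounter.formStratR p A Y g (ext W β v)) =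
      WindowCounter.formStratRG p A' Y' := by
    funext g v
    show Y (WindowCounter.vecF p A (ext W β v)) g (ext W β v) = Y (σ + WindowCounter.vecF p A' v) g (ext W β v)
    rw [vecF_ext]
  have h2 : ∀ v : Fin N → Bool, ringWinU c (WindowCounter.formStratR p A Y) (ext W β v) =
      ringWinGen (fun g : Fin (n + 1) => cut W g.val)
        (fun g : Fin (n + 1) => c + g.val + (SubcubeBells.wW W β + SubcubeBells.pW W β g.val))
        (WindowCounter.formStratRG p A' Y') v := fun v => by
    rw [SubcubeBells.ringWinU_ext, hstr]
  -- the generalised reduction applies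
  have hm : n + 1 ≤ 3 * N := by omega
  have hdense' : ∀ t : Fin r → ZMod p, t ≠ 0 →
      N ≤ lam * (univ.filter fun j : Fin N => WindowCounter.comb p t A' j ≠ 0).card := fun t ht => by
    have e : (univ.filter fun j : Fin N => WindowCounter.comb p t A' j ≠ 0).card =
        (univ.filter fun i : Fin n => i ∉ W ∧ WindowCounter.comb p t A i ≠ 0).card :=
      SubcubeBells.card_supp_res W (WindowCounter.comb p t A)
    rw [e]
    exact hdense t ht
  have hY'' : ∀ s g, ∃ J : Finset (Fin N), J.card ≤ (Nat.log 2 N) ^ 2 ∧ ∀ u v : Fin N → Bool,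
      (∀ i ∈ J, u i = v i) → Y' s g u = Y' s g v := fun s g => by
    obtain ⟨J, hJ, hdep⟩ := hY (σ + s) g
    obtain ⟨J', hJ', hdep'⟩ := SubcubeBells.junta_ext W β (f := fun u => Y (σ + s) g u) hdep
    exact ⟨J', hJ'.trans (hJ.trans (hN₁ N hNN₁ n hnN)), hdep'⟩
  have h3 := hN₀ N hNN₀ r lam hE' (n + 1) hm (fun g : Fin (n + 1) => cut W g.val)
    (fun g : Fin (n + 1) => c + g.val + (SubcubeBells.wW W β + SubcubeBells.pW W β g.val)) A' Y' hdense' hY''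
  have h4 : ((univ.filter fun v : Fin N → Bool =>
      ringWinU c (WindowCounter.formStratR p A Y) (ext W β v) = true).card : ℝ) ≤ θ₁ * 2 ^ N := by
    have e : (univ.filter fun v : Fin N → Bool => ringWinU c (WindowCounter.formStratR p A Y) (ext W β v) = true) =
        univ.filter fun v : Fin N → Bool => ringWinGen (fun g : Fin (n + 1) => cut W g.val)
          (fun g : Fin (n + 1) => c + g.val + (SubcubeBells.wW W β + SubcubeBells.pW W β g.val))
          (WindowCounter.formStratRG p A' Y') v = true := filter_congr fun v _ => by rw [h2]
    rw [e]
    exact h3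
  have h2n : (2 : ℝ) ^ n = 2 ^ W.card * 2 ^ N := by rw [← pow_add, hWn]
  calc ((univ.filter fun u : Fin n → Bool =>
          ringWinU c (WindowCounter.formStratR p A Y) (subcubeMerge W β u) = true).card : ℝ)
      ≤ 2 ^ W.card * ((univ.filter fun v : Fin N → Bool =>
          ringWinU c (WindowCounter.formStratR p A Y) (ext W β v) = true).card : ℝ) := by exact_mod_cast h1
    _ ≤ 2 ^ W.card * (θ₁ * 2 ^ N) := mul_le_mul_of_nonneg_left h4 (by positivity)
    _ = θ₁ * 2 ^ n := by rw [h2n]; ring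

/-- **THE SUBCUBE RANK INDUCTION WITH DENSITY `1/(2(R+1))` AND THE ADDITIVE BUDGET** (`p ≥ 5`): ONE `θ < 1`, ONE explicit
threshold `E·(R+1)³·(log₂ n)⁴ ≤ n`; for every `r ≤ R`, every subcube with `2(R+1)|W| + r·n ≤ R·n`, every `r`-form dial of
`log₂ n`-junta tables over ANY `r` directions: `#{u : WIN(merge_W β u)} ≤ θ·2ⁿ`. -/
theorem subRank_hardD (hp : 5 ≤ p) : ∃ θ : ℝ, θ < 1 ∧ ∃ E n₀ : ℕ, ∀ n ≥ n₀, ∀ R : ℕ,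
    E * (R + 1) ^ 3 * (Nat.log 2 n) ^ 4 ≤ n → ∀ r ≤ R,
    ∀ (W : Finset (Fin n)) (β : Fin n → Bool) (c : ℕ) (A : Fin r → Fin n → ZMod p)
      (Y : (Fin r → ZMod p) → Fin (n + 1) → (Fin n → Bool) → Bool),
      2 * (R + 1) * W.card + r * n ≤ R * n →
      (∀ s g, ∃ J : Finset (Fin n), J.card ≤ Nat.log 2 n ∧ ∀ u v : Fin n → Bool, (∀ i ∈ J, u i = v i) →
        Y s g u = Y s g v) →
      ((univ.filter fun u : Fin n → Bool =>
          ringWinU c (WindowCounter.formStratR p A Y) (subcubeMerge W β u) = true).card : ℝ) ≤ θ * 2 ^ n := by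
  obtain ⟨θ, hθ, E, n₀, hdense⟩ := subRank_denseD p hp
  refine ⟨θ, hθ, 4 * E, n₀, fun n hn R hE r => ?_⟩
  have hW2 : ∀ (W : Finset (Fin n)) (r : ℕ), 2 * (R + 1) * W.card + r * n ≤ R * n → 2 * W.card ≤ n := fun W r h => by
    by_contra h'
    push Not at h'
    have h1 := Nat.mul_le_mul_left (R + 1) (show n + 1 ≤ 2 * W.card from h')
    have h0 : 2 * (R + 1) * W.card ≤ R * n := le_trans (Nat.le_add_right _ _) h
    nlinarith [h1, h0]
  induction r with
  | zero =>
    intro _ W β c A Y hinv hY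
    exact hdense n hn 0 0 (by simp) W β c A Y (hW2 W 0 hinv) hY fun t ht => (ht (funext fun j => j.elim0)).elim
  | succ r ih =>
    intro hrR W β c A Y hinv hY
    have hEd : E * (r + 1 + 1) * (2 * (R + 1)) ^ 2 * (Nat.log 2 n) ^ 4 ≤ n :=
      calc E * (r + 1 + 1) * (2 * (R + 1)) ^ 2 * (Nat.log 2 n) ^ 4
          ≤ E * (R + 1) * (2 * (R + 1)) ^ 2 * (Nat.log 2 n) ^ 4 :=
            Nat.mul_le_mul_right _ (Nat.mul_le_mul_right _ (Nat.mul_le_mul_left _ (by omega)))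
        _ = 4 * E * (R + 1) ^ 3 * (Nat.log 2 n) ^ 4 := by ring
        _ ≤ n := hE
    by_cases hd : ∀ t : Fin (r + 1) → ZMod p, t ≠ 0 →
        n - W.card ≤ 2 * (R + 1) * (univ.filter fun i : Fin n => i ∉ W ∧ WindowCounter.comb p t A i ≠ 0).card
    · exact hdense n hn (r + 1) (2 * (R + 1)) hEd W β c A Y (hW2 W (r + 1) hinv) hY hd
    push Not at hd
    obtain ⟨t, ht, hsparse⟩ := hd
    -- the sparse combination: fix its off-`W` support too (cost `< (n − |W|)/(2(R+1))` coordinates)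
    set S : Finset (Fin n) := univ.filter fun i : Fin n => i ∉ W ∧ WindowCounter.comb p t A i ≠ 0 with hS
    set W' : Finset (Fin n) := W ∪ S with hW'
    have hWW' : W ⊆ W' := subset_union_left
    have hcW' : W'.card ≤ W.card + S.card := card_union_le _ _
    have hinv' : 2 * (R + 1) * W'.card + r * n ≤ R * n := by
      have h1 : 2 * (R + 1) * S.card < n := lt_of_lt_of_le hsparse (Nat.sub_le _ _)
      have h2 : 2 * (R + 1) * W'.card ≤ 2 * (R + 1) * W.card + 2 * (R + 1) * S.card := by
        rw [← Nat.mul_add]; exact Nat.mul_le_mul_left _ hcW'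
      linarith
    have hzero : ∀ i, i ∉ W' → WindowCounter.comb p t A i = 0 := fun i hi => by
      by_contra h
      exact hi (mem_union_right _ (mem_filter.2 ⟨mem_univ _, fun hW => hi (mem_union_left _ hW), h⟩))
    obtain ⟨j₀, hj₀⟩ : ∃ j₀, t j₀ ≠ 0 := by
      by_contra h
      push Not at h
      exact ht (funext h)
    set A' : Fin r → Fin n → ZMod p := fun j => A (j₀.succAbove j) with hA'
    -- every finer subcube is an `r`-form dial of junta tables, bounded by the induction hypothesis AT THE SAME `n`
    have hfib : ∀ b : Fin n → Bool, ((univ.filter fun u : Fin n → Bool =>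
        ringWinU c (WindowCounter.formStratR p A Y) (subcubeMerge W β (subcubeMerge W' b u)) = true).card : ℝ) ≤
          θ * 2 ^ n := by
      intro b
      have hconst : ∀ u : Fin n → Bool,
          WindowCounter.linF p (WindowCounter.comb p t A) (subcubeMerge W' (subcubeMerge W β b) u) =
            WindowCounter.linF p (WindowCounter.comb p t A) (subcubeMerge W β b) := fun u => by
        unfold WindowCounter.linF
        refine sum_congr rfl fun i _ => ?_
        by_cases hi : i ∈ W'
        · simp [subcubeMerge, hi]
        · simp [hzero i hi]
      set σ : ZMod p := WindowCounter.linF p (WindowCounter.comb p t A) (subcubeMerge W β b) with hσ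
      set Φ : (Fin r → ZMod p) → (Fin (r + 1) → ZMod p) :=
        fun s' => Fin.insertNth j₀ ((t j₀)⁻¹ * (σ - ∑ j, t (j₀.succAbove j) * s' j)) s' with hΦ
      set Y'' : (Fin r → ZMod p) → Fin (n + 1) → (Fin n → Bool) → Bool := fun s' g u => Y (Φ s') g u with hY''
      have hvec : ∀ u : Fin n → Bool, WindowCounter.vecF p A (subcubeMerge W' (subcubeMerge W β b) u) =
          Φ (WindowCounter.vecF p A' (subcubeMerge W' (subcubeMerge W β b) u)) := by
        intro u
        set u' := subcubeMerge W' (subcubeMerge W β b) u with hu'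
        have hrel : t j₀ * WindowCounter.vecF p A u' j₀ +
            ∑ j : Fin r, t (j₀.succAbove j) * WindowCounter.vecF p A u' (j₀.succAbove j) = σ := by
          rw [← Fin.sum_univ_succAbove (fun j => t j * WindowCounter.vecF p A u' j) j₀]
          show ∑ j, t j * WindowCounter.linF p (A j) u' = σ
          rw [← WindowCounter.linF_comb, hconst]
        have hx : WindowCounter.vecF p A u' j₀ =
            (t j₀)⁻¹ * (σ - ∑ j : Fin r, t (j₀.succAbove j) * WindowCounter.vecF p A u' (j₀.succAbove j)) := by
          rw [← hrel, add_sub_cancel_right, ← mul_assoc, inv_mul_cancel₀ hj₀, one_mul]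
        calc WindowCounter.vecF p A u'
            = Fin.insertNth j₀ (WindowCounter.vecF p A u' j₀) (Fin.removeNth j₀ (WindowCounter.vecF p A u')) :=
              (Fin.insertNth_self_removeNth j₀ _).symm
          _ = Φ (WindowCounter.vecF p A' u') := by
              rw [hx]
              rfl
      have hcount : (univ.filter fun u : Fin n → Bool =>
          ringWinU c (WindowCounter.formStratR p A Y) (subcubeMerge W β (subcubeMerge W' b u)) = true) =
          univ.filter fun u : Fin n → Bool =>
            ringWinU c (WindowCounter.formStratR p A' Y'') (subcubeMerge W' (subcubeMerge W β b) u) = true := by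
        refine filter_congr fun u _ => ?_
        have hyg : ∀ g, WindowCounter.formStratR p A Y g (subcubeMerge W' (subcubeMerge W β b) u) =
            WindowCounter.formStratR p A' Y'' g (subcubeMerge W' (subcubeMerge W β b) u) := fun g => by
          show Y (WindowCounter.vecF p A (subcubeMerge W' (subcubeMerge W β b) u)) g _ =
            Y (Φ (WindowCounter.vecF p A' (subcubeMerge W' (subcubeMerge W β b) u))) g _
          rw [hvec u]
        rw [SubcubeBells.merge_merge_of_subset hWW', UnreadTwist.ringWinU_congr hyg]
      rw [hcount]
      exact ih (by omega) W' (subcubeMerge W β b) c A' Y'' hinv' fun s' g => hY (Φ s') g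
    -- fibre counting over the finer subcubes
    have hsum := JLinPeel.sum_card_subcube W'
      (fun u : Fin n → Bool => ringWinU c (WindowCounter.formStratR p A Y) (subcubeMerge W β u) = true)
    have h2n : (0 : ℝ) < 2 ^ n := by positivity
    have hmain : (2 : ℝ) ^ n * ((univ.filter fun u : Fin n → Bool =>
        ringWinU c (WindowCounter.formStratR p A Y) (subcubeMerge W β u) = true).card : ℝ) ≤ 2 ^ n * (θ * 2 ^ n) := by
      have e : (2 : ℝ) ^ n * ((univ.filter fun u : Fin n → Bool =>
          ringWinU c (WindowCounter.formStratR p A Y) (subcubeMerge W β u) = true).card : ℝ) =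
          ∑ b : Fin n → Bool, ((univ.filter fun u : Fin n → Bool =>
            ringWinU c (WindowCounter.formStratR p A Y) (subcubeMerge W β (subcubeMerge W' b u)) = true).card : ℝ) := by
        exact_mod_cast hsum.symm
      rw [e]
      calc _ ≤ ∑ b : Fin n → Bool, θ * 2 ^ n := sum_le_sum fun b _ => hfib b
        _ = 2 ^ n * (θ * 2 ^ n) := by
            rw [sum_const, card_univ, Fintype.card_fun, Fintype.card_bool, Fintype.card_fin, nsmul_eq_mul]
            push_cast; ring
    exact le_of_mul_le_mul_left hmain h2n

/-- **RANK `R` WITH `E·(R+1)³·(log₂ n)⁴ ≤ n`: every `R`-form dial of `log₂ n`-junta tables over ANY `R` directions loses —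
ONE `θ`, ONE `E`, ONE `n₀` FOR ALL `R`** (`W = ∅`, `r = R`). -/
theorem rankRate_hard (hp : 5 ≤ p) : ∃ θ : ℝ, θ < 1 ∧ ∃ E n₀ : ℕ, ∀ n ≥ n₀, ∀ R : ℕ,
    E * (R + 1) ^ 3 * (Nat.log 2 n) ^ 4 ≤ n → ∀ (c : ℕ) (A : Fin R → Fin n → ZMod p)
      (Y : (Fin R → ZMod p) → Fin (n + 1) → (Fin n → Bool) → Bool),
      (∀ s g, ∃ J : Finset (Fin n), J.card ≤ Nat.log 2 n ∧ ∀ u v : Fin n → Bool, (∀ i ∈ J, u i = v i) →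
        Y s g u = Y s g v) →
      ((univ.filter fun u : Fin n → Bool => ringWinU c (WindowCounter.formStratR p A Y) u = true).card : ℝ) ≤
        θ * 2 ^ n := by
  obtain ⟨θ, hθ, E, n₀, h⟩ := subRank_hardD p hp
  refine ⟨θ, hθ, E, n₀, fun n hn R hE c A Y hY => ?_⟩
  have := h n hn R hE R le_rfl ∅ (fun _ => false) c A Y (by simp) hY
  simpa [SubcubeBells.merge_empty] using this

end SubRankD


section RankRateCorollaries

variable (p : ℕ) [Fact p.Prime]

/-- **GROWING RANK, data level**: for `p ≥ 5` there are `θ < 1`, `E`, `n₀` such that for all `n ≥ n₀` and ALL `R` with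
`E·(R+1)³·(log₂ n)⁴ ≤ n`, `log₂ n`-junta ⊕ form data whose non-blind cuts' forms lie in the span of ANY `R` directions lose. -/
theorem rankRate_hard_unif (hp : 5 ≤ p) : ∃ θ : ℝ, θ < 1 ∧ ∃ E n₀ : ℕ, ∀ n ≥ n₀, ∀ R : ℕ,
    E * (R + 1) ^ 3 * (Nat.log 2 n) ^ 4 ≤ n → ∀ (c : ℕ) (D : JLinData p n), (∀ g, (D.J g).card ≤ Nat.log 2 n) →
      (∃ A : Fin R → Fin n → ZMod p,
        ∀ g, ¬ (∀ u s s', D.h g u s = D.h g u s') → ∃ l : Fin R → ZMod p, D.a g = fun i => ∑ j, l j * A j i) →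
      (winCount c D.strat : ℝ) ≤ θ * (2 : ℝ) ^ n := by
  obtain ⟨θ, hθ, E, n₀, h⟩ := rankRate_hard p hp
  refine ⟨θ, hθ, E, n₀, fun n hn R hE c D hJ hR => ?_⟩
  obtain ⟨A, hA⟩ := hR
  obtain ⟨Y, hY, hstrat⟩ := strat_eq_formStratR D A hA
  rw [hstrat]
  exact h n hn R hE c A Y fun s g => ⟨D.J g, hJ g, fun u v huv => hY s g u v huv⟩

/-- **EVERY ADMISSIBLE RATE FUNCTION IS A THEOREM**: if `∀ E, eventually E·(ρ n + 1)³·(log₂ n)⁴ ≤ n`, then `log₂ n`-junta ⊕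
form data of rank `≤ ρ(n)` lose (every prime `p ≥ 5`). -/
theorem rankFn_hard (hp : 5 ≤ p) (ρ : ℕ → ℕ)
    (hρ : ∀ E : ℕ, ∃ n₁ : ℕ, ∀ n ≥ n₁, E * (ρ n + 1) ^ 3 * (Nat.log 2 n) ^ 4 ≤ n) :
    ∃ θ : ℝ, θ < 1 ∧ ∃ n₀ : ℕ, ∀ n ≥ n₀, ∀ (c : ℕ) (D : JLinData p n), (∀ g, (D.J g).card ≤ Nat.log 2 n) →
      (∃ A : Fin (ρ n) → Fin n → ZMod p,
        ∀ g, ¬ (∀ u s s', D.h g u s = D.h g u s') → ∃ l : Fin (ρ n) → ZMod p, D.a g = fun i => ∑ j, l j * A j i) →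
      (winCount c D.strat : ℝ) ≤ θ * (2 : ℝ) ^ n := by
  obtain ⟨θ, hθ, E, n₀, h⟩ := rankRate_hard_unif p hp
  obtain ⟨n₁, hn₁⟩ := hρ E
  exact ⟨θ, hθ, max n₀ n₁, fun n hn c D hJ hR =>
    h n (le_trans (le_max_left _ _) hn) (ρ n) (hn₁ n (le_trans (le_max_right _ _) hn)) c D hJ hR⟩

/-- polylogarithmic rates `(log₂ n)^d` are admissible. -/
theorem polylog_rate_admissible (d E : ℕ) :
    ∃ n₁ : ℕ, ∀ n ≥ n₁, E * ((Nat.log 2 n) ^ d + 1) ^ 3 * (Nat.log 2 n) ^ 4 ≤ n := by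
  obtain ⟨N₀, hN₀⟩ := DWalk.const_mul_logPow_le' (8 * E) (d * 3 + 4)
  refine ⟨max N₀ 2, fun n hn => ?_⟩
  have hn2 : 2 ≤ n := le_trans (le_max_right _ _) hn
  set ℓ := Nat.log 2 n with hℓdef
  have hℓ : 1 ≤ ℓ := Nat.le_log_of_pow_le one_lt_two (by rw [pow_one]; exact hn2)
  have h1 : ℓ ^ d + 1 ≤ 2 * ℓ ^ d := by have := Nat.one_le_pow d ℓ hℓ; omega
  calc E * (ℓ ^ d + 1) ^ 3 * ℓ ^ 4 ≤ E * (2 * ℓ ^ d) ^ 3 * ℓ ^ 4 :=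
        Nat.mul_le_mul_right _ (Nat.mul_le_mul_left _ (Nat.pow_le_pow_left h1 3))
    _ = 8 * E * ((ℓ ^ d) ^ 3 * ℓ ^ 4) := by ring
    _ = 8 * E * ℓ ^ (d * 3 + 4) := by rw [← pow_mul, ← pow_add]
    _ ≤ n := hN₀ n (le_trans (le_max_left _ _) hn)

/-- the CUBE-ROOT RATE: the largest `ρ ≤ n` with `ρ³·(log₂ n)⁵ ≤ n` (so `ρ_cube(n) ≈ (n / log₂⁵ n)^{1/3}`). -/
def cubeRate (n : ℕ) : ℕ := Nat.findGreatest (fun ρ => ρ ^ 3 * (Nat.log 2 n) ^ 5 ≤ n) n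

/-- CharDialRankRate helper `cubeRate_spec` (decomp-qadv land package; see the module docstring). -/
theorem cubeRate_spec (n : ℕ) : cubeRate n ^ 3 * (Nat.log 2 n) ^ 5 ≤ n :=
  Nat.findGreatest_spec (P := fun ρ => ρ ^ 3 * (Nat.log 2 n) ^ 5 ≤ n) (Nat.zero_le n) (by simp)

/-- every rate below the cube-root budget is dominated by `cubeRate`. -/
theorem le_cubeRate {n ρ : ℕ} (hρn : ρ ≤ n) (h : ρ ^ 3 * (Nat.log 2 n) ^ 5 ≤ n) : ρ ≤ cubeRate n :=
  Nat.le_findGreatest (P := fun ρ => ρ ^ 3 * (Nat.log 2 n) ^ 5 ≤ n) hρn h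

/-- the cube-root rate is admissible. -/
theorem cubeRate_admissible (E : ℕ) : ∃ n₁ : ℕ, ∀ n ≥ n₁, E * (cubeRate n + 1) ^ 3 * (Nat.log 2 n) ^ 4 ≤ n := by
  obtain ⟨N₀, hN₀⟩ := DWalk.const_mul_logPow_le' E 4
  refine ⟨max N₀ (2 ^ (8 * E)), fun n hn => ?_⟩
  have hN : N₀ ≤ n := le_trans (le_max_left _ _) hn
  have hpow : 2 ^ (8 * E) ≤ n := le_trans (le_max_right _ _) hn
  set ℓ := Nat.log 2 n with hℓdef
  have hEℓ : 8 * E ≤ ℓ := Nat.le_log_of_pow_le one_lt_two hpow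
  have hspec : cubeRate n ^ 3 * ℓ ^ 5 ≤ n := cubeRate_spec n
  rcases Nat.eq_zero_or_pos (cubeRate n) with h0 | hpos
  · rw [h0]; simpa using hN₀ n hN
  · have h1 : cubeRate n + 1 ≤ 2 * cubeRate n := by omega
    calc E * (cubeRate n + 1) ^ 3 * ℓ ^ 4 ≤ E * (2 * cubeRate n) ^ 3 * ℓ ^ 4 :=
          Nat.mul_le_mul_right _ (Nat.mul_le_mul_left _ (Nat.pow_le_pow_left h1 3))
      _ = 8 * E * (cubeRate n ^ 3 * ℓ ^ 4) := by ring
      _ ≤ ℓ * (cubeRate n ^ 3 * ℓ ^ 4) := Nat.mul_le_mul_right _ hEℓ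
      _ = cubeRate n ^ 3 * ℓ ^ 5 := by ring
      _ ≤ n := hspec

/-- **LOG RANK IS A THEOREM**: `log₂ n`-junta ⊕ form data of rank `≤ log₂ n` («as many independent forms as junta bits») lose,
every prime `p ≥ 5`. -/
theorem logRank_hard (hp : 5 ≤ p) :
    ∃ θ : ℝ, θ < 1 ∧ ∃ n₀ : ℕ, ∀ n ≥ n₀, ∀ (c : ℕ) (D : JLinData p n), (∀ g, (D.J g).card ≤ Nat.log 2 n) →
      (∃ A : Fin (Nat.log 2 n) → Fin n → ZMod p,
        ∀ g, ¬ (∀ u s s', D.h g u s = D.h g u s') → ∃ l : Fin (Nat.log 2 n) → ZMod p, D.a g = fun i => ∑ j, l j * A j i) →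
      (winCount c D.strat : ℝ) ≤ θ * (2 : ℝ) ^ n :=
  rankFn_hard p hp (Nat.log 2) fun E => by simpa only [pow_one] using polylog_rate_admissible 1 E

/-- **EVERY POLYLOG RANK IS A THEOREM**: rank `≤ (log₂ n)^d`, any `d`. -/
theorem polylogRank_hard (hp : 5 ≤ p) (d : ℕ) :
    ∃ θ : ℝ, θ < 1 ∧ ∃ n₀ : ℕ, ∀ n ≥ n₀, ∀ (c : ℕ) (D : JLinData p n), (∀ g, (D.J g).card ≤ Nat.log 2 n) →
      (∃ A : Fin ((Nat.log 2 n) ^ d) → Fin n → ZMod p,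
        ∀ g, ¬ (∀ u s s', D.h g u s = D.h g u s') → ∃ l : Fin ((Nat.log 2 n) ^ d) → ZMod p,
          D.a g = fun i => ∑ j, l j * A j i) →
      (winCount c D.strat : ℝ) ≤ θ * (2 : ℝ) ^ n :=
  rankFn_hard p hp (fun n => (Nat.log 2 n) ^ d) (polylog_rate_admissible d)

/-- **THE CUBE-ROOT RANK IS A THEOREM**: rank `≤ ρ_cube(n) ≈ (n/log⁵ n)^{1/3}` — the honest reach of the slicing engine. -/
theorem cubeRank_hard (hp : 5 ≤ p) :
    ∃ θ : ℝ, θ < 1 ∧ ∃ n₀ : ℕ, ∀ n ≥ n₀, ∀ (c : ℕ) (D : JLinData p n), (∀ g, (D.J g).card ≤ Nat.log 2 n) →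
      (∃ A : Fin (cubeRate n) → Fin n → ZMod p,
        ∀ g, ¬ (∀ u s s', D.h g u s = D.h g u s') → ∃ l : Fin (cubeRate n) → ZMod p, D.a g = fun i => ∑ j, l j * A j i) →
      (winCount c D.strat : ℝ) ≤ θ * (2 : ℝ) ^ n :=
  rankFn_hard p hp cubeRate cubeRate_admissible

end RankRateCorollaries

end Summit.QuantumAdvantage.AdviceFreeQNC0.JLinPeel
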